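import Summits.RiemannHypothesis.RiemannHypothesis.Theorems.JensenLogBandArcWindowForm
import Summits.RiemannHypothesis.RiemannHypothesis.Theorems.JensenLogBandLaplaceCore
import Mathlib.MeasureTheory.Integral.DominatedConvergence
import HarnessLib

/-!
# The window main term of the right half-arc transform (BAND line, step S5-1)

RH ladder column JENSEN, rung J-P(P3) «log band», BAND crux `XiDerivBandRealAllRates` of route
«JensenLogBand», line «band-one-window» (u-arc reshape), lead rh-jensen-prover g7 — step (S5-1) of
HOME/rh-jensen-prover/g7-work/LINE-PLAN.md §8.5: Laplace's method ON THE WINDOW, with the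
`ζ`-amplitude kept abstract (`g`, `‖g − 1‖ ≤ η` — supplied per regime by `JensenLogBandZetaWindow`
(R2) or `JensenLogBandZetaFarRight` (R1)). RH-FREE. WHAT THIS IS NOT: nothing here bears on zeros of
`ζ` or the truth of RH.

`window_main_term`: for the saddle `u*` (`r = ‖u*−c‖`, `φ₀ = arg(u*−c)`,
`w = S′(u*)(u*−c)²/2`), `0 < ψ₁ ≤ 11/320`, `rψ₁ ≤ h/20`, and a continuous `g` with `‖g − 1‖ ≤ η` on
`[−ψ₁, ψ₁]`:

  `‖∫_{−ψ₁}^{ψ₁} I(φ₀+ψ)·g(ψ) dψ − I(φ₀)·(π/w)^{1/2}‖ ≤ ‖I(φ₀)‖·(16(1+η)n/(Re w)² + η√(π/Re w) + 2e^{−Re w ψ₁²}/(Re w ψ₁))`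

(`I = arcModelIntegrand n r c`; `laplace_window_core` p483889 with `K = 4n` from `window_exp_form`).
-/

noncomputable section

-- single-problem summit: `Summit.RiemannHypothesis.RiemannHypothesis.…` is the tree convention
set_option linter.dupNamespace false

open Complex Real Set MeasureTheory intervalIntegral

namespace Summit.RiemannHypothesis.RiemannHypothesis.Theorems.JensenPolynomials.LogBandArc

open Literature.NumberTheory.LFunctions

variable {n : ℕ} {x T : ℝ} {ustar : ℂ}

/-- **Window main term (S5-1).** See the module docstring. [folklore] -/
theorem window_main_term (hx : |x| ≤ 1 / 2) (hT : 100 ≤ T) (hℓ : 20 ≤ ell T)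
    (hn : 100 ≤ n) (hh : 1 / 2 ≤ bandRadius n T) (hhT : bandRadius n T ≤ 7 / 20 * T)
    (hustar : ‖ustar - ((x : ℂ) + (T : ℂ) * I + bandRadius n T)‖ ≤ 3 / 5 * bandRadius n T)
    (hS : arcSaddleFn n ((x : ℂ) + (T : ℂ) * I) ustar = 0) {ψ₁ η : ℝ} (hψ₁ : 0 < ψ₁)
    (hψ₁s : ψ₁ ≤ 11 / 320)
    (hψ₁r : ‖ustar - ((x : ℂ) + (T : ℂ) * I)‖ * ψ₁ ≤ 1 / 20 * bandRadius n T) (hη : 0 ≤ η)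
    {g : ℝ → ℂ} (hgc : ContinuousOn g (Icc (-ψ₁) ψ₁)) (hg : ∀ ψ ∈ Icc (-ψ₁) ψ₁, ‖g ψ - 1‖ ≤ η) :
    let c : ℂ := (x : ℂ) + (T : ℂ) * I
    let r : ℝ := ‖ustar - c‖
    let φ₀ : ℝ := Complex.arg (ustar - c)
    let w : ℂ := deriv (arcSaddleFn n c) ustar * (ustar - c) ^ 2 / 2
    ‖(∫ ψ in (-ψ₁)..ψ₁, arcModelIntegrand n r c (φ₀ + ψ) * g ψ) -
        arcModelIntegrand n r c φ₀ * ((π : ℂ) / w) ^ (1 / 2 : ℂ)‖ ≤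
      ‖arcModelIntegrand n r c φ₀‖ * (4 * (1 + η) * (4 * n) / w.re ^ 2 + η * Real.sqrt (π / w.re) +
        2 / (w.re * ψ₁) * Real.exp (-w.re * ψ₁ ^ 2)) := by
  intro c r φ₀ w
  have hT0 : 0 < T := by linarith
  obtain ⟨hre_pos, -, -, -, -⟩ := arcSaddle_polar_bounds hx hT hℓ hn hh hhT hustar hS
  have hw0 : ustar - c ≠ 0 := by
    intro h0
    have h' : (0 : ℝ) < (ustar - c).re := hre_pos
    rw [h0] at h'; simp at h'
  have hr0 : 0 < r := norm_pos_iff.2 hw0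
  -- curvature
  obtain ⟨-, hwre, -⟩ := descentDensity_saddle hx hT hℓ hn hh hhT hustar hS
  have hwre' : (11 / 40 : ℝ) * n ≤ w.re := hwre
  have hnpos : (0 : ℝ) < n := by exact_mod_cast (show 0 < n by omega)
  have hw : 0 < w.re := by linarith [hwre']
  -- the window remainder `E`
  set q : ℝ → ℂ := descentDensity n c r with hq
  set E : ℝ → ℂ := fun ψ => (∫ t in φ₀..φ₀ + ψ, q t) + w * (ψ : ℂ) ^ 2 with hE
  have hwin : ∀ ψ ∈ Icc (-ψ₁) ψ₁, r * |ψ| ≤ 1 / 20 * bandRadius n T := by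
    intro ψ hψ
    have : |ψ| ≤ ψ₁ := abs_le.2 ⟨hψ.1, hψ.2⟩
    exact (mul_le_mul_of_nonneg_left this hr0.le).trans hψ₁r
  have hform : ∀ ψ ∈ Icc (-ψ₁) ψ₁,
      arcModelIntegrand n r c (φ₀ + ψ) = arcModelIntegrand n r c φ₀ * cexp (-w * (ψ : ℂ) ^ 2 + E ψ) ∧
        ‖E ψ‖ ≤ 4 * n * |ψ| ^ 3 :=
    fun ψ hψ => window_exp_form hx hT hℓ hn hh hhT hustar hS (hwin ψ hψ)
  -- continuity of `E` on the window: primitive of the continuous `q`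
  have hqcont : ∀ t ∈ uIcc (φ₀ - ψ₁) (φ₀ + ψ₁), ContinuousAt q t := by
    intro t ht
    have ht' : r * |t - φ₀| ≤ 1 / 20 * bandRadius n T := by
      have h1 : |t - φ₀| ≤ ψ₁ := by
        rw [uIcc_of_le (by linarith)] at ht
        exact abs_le.2 ⟨by linarith [ht.1], by linarith [ht.2]⟩
      exact (mul_le_mul_of_nonneg_left h1 hr0.le).trans hψ₁r
    obtain ⟨hmem, -, -, -, -⟩ := window_admissible hx hT hℓ hn hh hhT hustar hS ht'
    exact (hasDerivAt_descentDensity_eq hx hT hh hhT hmem).continuousAt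
  have hPcont : ContinuousOn (fun b => ∫ t in φ₀..b, q t) (uIcc (φ₀ - ψ₁) (φ₀ + ψ₁)) := by
    refine intervalIntegral.continuousOn_primitive_interval' ?_ ?_
    · exact (ContinuousOn.intervalIntegrable fun t ht => (hqcont t ht).continuousWithinAt)
    · rw [uIcc_of_le (by linarith)]; exact ⟨by linarith, by linarith⟩
  have hEc : ContinuousOn E (Icc (-ψ₁) ψ₁) := by
    have hshift : ContinuousOn (fun ψ : ℝ => ∫ t in φ₀..φ₀ + ψ, q t) (Icc (-ψ₁) ψ₁) := by
      refine hPcont.comp (continuous_const.add continuous_id).continuousOn ?_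
      intro ψ hψ
      rw [uIcc_of_le (by linarith)]
      exact ⟨by simp; linarith [hψ.1], by simp; linarith [hψ.2]⟩
    have hpoly : Continuous fun ψ : ℝ => w * (ψ : ℂ) ^ 2 := by fun_prop
    exact hshift.add hpoly.continuousOn
  have hEb : ∀ ψ ∈ Icc (-ψ₁) ψ₁, ‖E ψ‖ ≤ 4 * n * |ψ| ^ 3 := fun ψ hψ => (hform ψ hψ).2
  -- Laplace core
  have hK : (0 : ℝ) ≤ 4 * n := by positivity
  have hKψ : 4 * (n : ℝ) * ψ₁ ≤ w.re / 2 := by nlinarith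
  have hcore := laplace_window_core hw hψ₁ hK hη hKψ hEc hgc hEb hg
  -- factor out `I(φ₀)`
  have hint_eq : (∫ ψ in (-ψ₁)..ψ₁, arcModelIntegrand n r c (φ₀ + ψ) * g ψ) =
      arcModelIntegrand n r c φ₀ * ∫ ψ in (-ψ₁)..ψ₁, cexp (-w * (ψ : ℂ) ^ 2 + E ψ) * g ψ := by
    rw [← intervalIntegral.integral_const_mul]
    refine intervalIntegral.integral_congr fun ψ hψ => ?_
    rw [uIcc_of_le (by linarith)] at hψ
    show arcModelIntegrand n r c (φ₀ + ψ) * g ψ = arcModelIntegrand n r c φ₀ * (cexp (-w * (ψ : ℂ) ^ 2 + E ψ) * g ψ)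
    rw [(hform ψ hψ).1, mul_assoc]
  rw [hint_eq, ← mul_sub, norm_mul]
  exact mul_le_mul_of_nonneg_left hcore (norm_nonneg _)

end Summit.RiemannHypothesis.RiemannHypothesis.Theorems.JensenPolynomials.LogBandArc

end
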